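import Literature.Barriers.CriticalPhenomena.LaceExpansionBubbleFiveDimSubcritical
import Literature.Barriers.CriticalPhenomena.LaceExpansionBubbleFiveDimContinuity
import HarnessLib

/-!
# Hara–Slade 1992, Theorem 2.5 — layer 3: Part II's own reduction (Theorem II.1.1 (1.20) from
# Theorem II.1.4 for `d = 5` and Appendix C for `d ≥ 6`), with its printed constants, PROVED as
# an assembly whose hypotheses are the subcritical bootstrap outputs

Barrier catalogue `Literature/Barriers/CriticalPhenomena/` (D-0021), sibling of
`LaceExpansionBubbleFiveDim.lean`, whose named fact `HaraSlade1992_thm25` is Part I, Theorem 2.5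
(= the clause (1.20) of Part II, Theorem 1.1): for `d ≥ 5` and `|z| ≤ z_c`,
`‖|x|² G_z(x)‖_∞ ≤ C₁`, `‖G_z - δ₀‖₂² ≤ C₂`, `C₂(1 + C₂) < 1`.

D-0026 / D-0027 (facts are inline-or-verdict; decompositions do not recurse): this file mints NO
named fact. The printed intermediate results of Part II below Theorem 1.1 — Theorem 1.4 (`d = 5`)
and the bounds of Appendix C (`d ≥ 6`), both statements about real activities `0 ≤ p < z_c` and
both outputs of the paper's computer-assisted bootstrap — enter only as HYPOTHESES of proved
assembly theorems, spelled out with their printed constants. `HaraSlade1992_thm25` therefore stays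
the single leaf of the chain `HaraSlade1992_bubbleCondition ⇐ HaraSlade1992_thm25`
(`HaraSlade1992_bubbleCondition_of_thm25`, `LaceExpansionBubbleFiveDim.lean`), and its discharge is
reached through the subcritical statement "(1.20) for real `0 ≤ p < z_c`" below
(`HaraSlade1992_thm25_of_eq120_subcritical`).

## What the source prints (T. Hara, G. Slade, *The lace expansion for self-avoiding walk in five
## or more dimensions*, Rev. Math. Phys. 4 (1992) 235–327 = "Part II")

* **Theorem 1.1** (p. 242): "For `d ≥ 5` … For `|z| ≤ z_c`, `‖|x|² G_z(x)‖_∞ ≤ 0.1425`,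
  `‖G_z(x) - δ_{0,x}‖₂² ≡ B_z(0) ≤ 0.493` (1.20)"; (1.5): `B_z(0) = Σ_{x ≠ 0} G_z(x)²`; p. 242:
  "`p` to denote a nonnegative activity", `|x| = [x₁² + ⋯ + x_d²]^{1/2}`. "The following is a
  restatement of Theorems I.2.5–I.2.7 and an extension of Theorem I.2.8."
* §1.3 (p. 243–247), the reduction for `d = 5`: Definition 1.3 — `P_z(α)` is the list
  (1.39)–(1.44) of thirteen inequalities, the first being `|B_z(0)| ≤ α·(0.493)`; `Q_z` is the
  list (1.45)–(1.53), the first being `sup_{x ∈ ℤ^d} |x|²|G_z(x)| ≤ 0.1425` (1.45).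
  **Theorem 1.4.** "For `d = 5` and `p ∈ [0, z_c)`, the inequalities `P_p(0.999)` and `Q_p` hold."
  **Corollary 1.5.** "For `d = 5` and `|z| ≤ z_c`, the inequalities `P_z(0.999)` and `Q_z` hold."
  "Proof of Theorem 1.1, given Theorem 1.4, Corollary 1.5 and Proposition 1.6. … The
  inequalities of (1.20) are given by (1.45) and (1.39)." "Proof of Corollary 1.5, given
  Theorem 1.4. The monotone convergence theorem can be used in a straightforward manner to extend
  the bounds of `P_p(0.999)` and `Q_p` from `p ∈ [0, z_c)` to `p = z_c`. These bounds then extend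
  to `|z| ≤ z_c`, since we are dealing with power series with nonnegative coefficients".
  §1.4: Theorem 1.4 is proved by the bootstrap Lemma 1.11 from Proposition 1.7 (`p ≤ p₀ =
  6611/9⁵`, comparison with the Gaussian two-point function `G_p(x) ≤ (713988/812911) I_{1,0}(x)`,
  Proposition A.3 and the numerics of App. B), Proposition 1.8 (continuity), Proposition 1.9
  ("For any fixed `p ∈ [p₀, z_c)`, if the set of inequalities `P_p(1)` holds then in fact the
  stronger set of inequalities `P_p(0.999)` must hold" — "the core of the proof", Secs. 2–4) and
  Lemma 1.10 (`P_p(1) ⇒ Q_p`). §1.5: "the entire calculation described in this paper was done by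
  computer, using a FORTRAN program … Computer calculations were also used to evaluate precisely
  the simple random walk (Gaussian) Green function, at several thousand lattice sites. Rigorous
  error bounds were obtained for the computer calculations" (App. B).
* **Appendix C** (p. 323–326), `d ≥ 6`: "The numerical estimates given throughout the paper are
  for `d = 5` … Because these Gaussian quantities become smaller as the dimension increases, the
  proof becomes relatively easier." C.1, `6 ≤ d ≤ 9`: "For the inequalities `P_p(α)` we now take
  just the three inequalities `B_p(0) ≤ (0.26)·α`, `sup_{x≠0} B'_p(x) ≤ (0.26)·α`,
  `sup_{x≠0} |x|² G_p(x) ≤ (0.11)·α` (C.1). We use `p₀ ≡ 1/(2d-1)` … We omit any detailed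
  account of the calculation, but only give the resulting bounds … `B_p(0) ≤ 0.26` (C.3)".
  C.2, `d ≥ 10`: Lemma C.1 (the Gaussian integrals `I_{n,m}(0)` are monotone decreasing in `d`,
  with the values (C.4)–(C.5) at `d = 10`); "For `d ≥ 10`, we take for `P_p(α)` simply
  `B_p(0) ≤ 0.10`, `sup_x |x|² G_p(x) ≤ 0.10` (C.6)"; "(C.10) … and can complete the proof that
  `P_p(0.999)` is satisfied." Proof of Theorem 1.1, p. 245: "For `d ≥ 6`, we proceed
  similarly, now using … `B_{z_c}(0) ≤ 0.26`. (See Appendix C for these bounds.)"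

## What is formalised (namespace `Literature.Barriers.CriticalPhenomena`; everything PROVED)

* `hsBubble_eq_tsum_ite`: the tree's `hsBubble d z = ‖G_z^{(1)}‖₂²` IS Part II's
  `B_z(0) = Σ_{x≠0} G_z(x)²` (1.5) (`G_z^{(1)}(0) = 0`, `G_z^{(1)}(x) = G_z(x)` for `x ≠ 0`); the
  tree's `hsSup d z` is `sup_x |x|² G_z(x)` (and equals `sup_{x≠0}`, the `x = 0` term being `0`:
  `hsSup_eq_iSup_ne_zero`).
* `HaraSlade1992b_lemma111` — Lemma 1.11 exactly as printed (thresholds `0.999` and `1`,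
  hypothesis at `p₀` only, conclusion on `[p₀, p₁)`), from `Slade2006_lem59` applied to `f_max`.
* **The assembly "Proof of Theorem 1.1 (1.20), given Theorem 1.4 / Appendix C and
  Corollary 1.5"**, with the bootstrap outputs as explicit hypotheses (no named facts):
  `HaraSlade1992_thm25At_of_subcritical_bounds` (any `d ≥ 1`: bounds `B_p(0) ≤ b ≤ 0.493`,
  `sup|x|²G_p ≤ s ≤ 0.1425` uniform in `0 ≤ p < z_c` give `HaraSlade1992_thm25At d` with
  `C₁ = 0.1425`, `C₂ = 0.493`, `0.493 · 1.493 < 1`), and its printed instances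
  `HaraSlade1992_thm25At_five_of_thm14` (hypothesis = Theorem 1.4's clauses (1.39)₁, (1.45)),
  `HaraSlade1992_thm25At_of_appC1` (`6 ≤ d ≤ 9`, hypothesis = (C.1)/(C.3) with `α = 1`),
  `HaraSlade1992_thm25At_of_appC2` (`d ≥ 10`, hypothesis = (C.6)), `HaraSlade1992_thm25At_of_appC`
  (both, `d ≥ 6`),
  `HaraSlade1992_thm25_of_partII` (all `d ≥ 5` from the three), and the one-hypothesis form
  `HaraSlade1992_thm25_of_eq120_subcritical` (hypothesis = (1.20) for real `0 ≤ p < z_c`, all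
  `d ≥ 5`), plus `HaraSlade1992_bubbleCondition_of_eq120_subcritical` /
  `HaraSlade1992_bubbleCondition_of_partII` (the parent fact straight from these hypotheses).
  The passage from `p < z_c` to `0 ≤ z ≤ z_c` is the proved monotone-convergence step
  `HaraSlade1992_thm25At_of_forall_Ioo` (`LaceExpansionBubbleFiveDimSubcritical.lean`).

After this file the named-fact chain is `HaraSlade1992_bubbleCondition ⇐ HaraSlade1992_thm25`
only; a discharge of `HaraSlade1992_thm25` is obtained by supplying the hypothesis of
`HaraSlade1992_thm25_of_eq120_subcritical` (the statement Part II actually proves, by its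
computer-assisted bootstrap: Theorem 1.4, Appendix C — strictly below Theorem II.1.1 in the
source's own reduction), or the three finer hypotheses of `HaraSlade1992_thm25_of_partII`; the
generic frame of that bootstrap is
already proved in the tree (`HaraSlade1992_thm25At_of_bootstrap`, `apriori_of_srw`,
`LaceExpansionBubbleFiveDimBootstrap.lean`; the large-`d` analogue is proved outright:
`Slade2006_thm51_holds`, `LaceExpansionSAWLemma516.lean`).
-/

noncomputable section

open Filter Topology Set Literature.Probability.LatticeModels Literature.Probability.Percolation
  Literature.Probability.RandomPlanarGeometry.SAW.Zd
open scoped ENNReal BigOperators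

namespace Literature.Barriers.CriticalPhenomena

variable {d : ℕ}

/-! ### The tree's two norms are Part II's `B_z(0)` and `sup_x |x|² G_z(x)` -/

/-- `‖G_z^{(1)}‖₂² = Σ_{x ≠ 0} G_z(x)² = B_z(0)`: the Hara–Slade bubble of the tree is the bubble
diagram (1.5) of Part II (the zero-step walk contributes only at `x = 0`, where `G_z^{(1)}`
vanishes). [cite: HaraSlade1992b, eq. (1.5) and (1.20)] -/
theorem hsBubble_eq_tsum_ite (d : ℕ) (z : ℝ) :
    hsBubble d z = ∑' x : Site d, if x = 0 then 0 else twoPointENN d z x ^ 2 := by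
  classical
  unfold hsBubble
  refine tsum_congr fun x => ?_
  split_ifs with hx
  · rw [hx, twoPointENN₁_zero, zero_pow two_ne_zero]
  · rw [twoPointENN_eq_ite_add, if_neg hx, zero_add]

/-- `sup_x |x|² G_z(x) = sup_{x ≠ 0} |x|² G_z(x)` (the `x = 0` term is `0`): the two printed forms
of the sup-norm, (1.45)/(C.6) over all `x` and (C.1) over `x ≠ 0`, agree.
[cite: HaraSlade1992b, eqs. (1.45), (C.1), (C.6)] -/
theorem hsSup_eq_iSup_ne_zero (d : ℕ) (z : ℝ) :
    hsSup d z = ⨆ x : {x : Site d // x ≠ 0}, ENNReal.ofReal (normSq x.1) * twoPointENN d z x.1 := by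
  unfold hsSup
  refine le_antisymm (iSup_le fun x => ?_) (iSup_le fun x => le_iSup (fun y : Site d =>
    ENNReal.ofReal (normSq y) * twoPointENN d z y) x.1)
  by_cases hx : x = 0
  · have h0 : normSq x = 0 := by simp [hx, normSq]
    rw [h0, ENNReal.ofReal_zero, zero_mul]
    exact zero_le
  · exact le_iSup (fun y : {y : Site d // y ≠ 0} =>
      ENNReal.ofReal (normSq y.1) * twoPointENN d z y.1) ⟨x, hx⟩

/-- `sup_{x ≠ 0} |x|² G_z(x) ≤ C` gives `|x|² G_z(x) ≤ C` for every `x` (at `x = 0` the left side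
is `0`). [cite: HaraSlade1992b, eqs. (1.45), (C.1)] -/
theorem normSq_mul_twoPointENN_le_of_ne_zero {z : ℝ} {C : ℝ≥0∞}
    (h : ∀ x : Site d, x ≠ 0 → ENNReal.ofReal (normSq x) * twoPointENN d z x ≤ C) (x : Site d) :
    ENNReal.ofReal (normSq x) * twoPointENN d z x ≤ C := by
  by_cases hx : x = 0
  · have h0 : normSq x = 0 := by simp [hx, normSq]
    rw [h0, ENNReal.ofReal_zero, zero_mul]
    exact zero_le
  · exact h x hx

/-! ### Lemma 1.11 (the bootstrap lemma, as printed) -/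

/-- **Hara–Slade 1992 (Part II), Lemma 1.11**: "Suppose that `f₁(p), …, f_n(p)` are nonnegative
functions, and that there are `p₀ < p₁` such that 1. `f_m(p₀) ≤ 0.999` for `1 ≤ m ≤ n`,
2. `f_m(p)` is continuous in `p ∈ [p₀, p₁)` for each `1 ≤ m ≤ n`, 3. for each fixed
`p ∈ [p₀, p₁)`, the set of inequalities `f_m(p) ≤ 1` (`1 ≤ m ≤ n`) implies the stronger set of
inequalities `f_m(p) ≤ 0.999` (`1 ≤ m ≤ n`). Then `f_m(p) ≤ 0.999` for all `p ∈ [p₀, p₁)`."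
(Nonnegativity and `p₀ < p₁` are not used; hypothesis 3 is needed only on `(p₀, p₁)`.) Proof as
printed: `f_max` is continuous, `≤ 0.999` at `p₀`, and never in the forbidden interval
`(0.999, 1]` — Slade's Lemma 5.9 (`Slade2006_lem59`). [cite: HaraSlade1992b, Lemma 1.11] -/
theorem HaraSlade1992b_lemma111 {ι : Type*} [Finite ι] {f : ι → ℝ → ℝ} {p₀ p₁ : ℝ}
    (h1 : ∀ m, f m p₀ ≤ 0.999) (h2 : ∀ m, ContinuousOn (f m) (Set.Ico p₀ p₁))
    (h3 : ∀ p ∈ Set.Ico p₀ p₁, (∀ m, f m p ≤ 1) → ∀ m, f m p ≤ 0.999) :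
    ∀ m, ∀ p ∈ Set.Ico p₀ p₁, f m p ≤ 0.999 := by
  intro m p hp
  haveI : Fintype ι := Fintype.ofFinite ι
  have hne : (Finset.univ : Finset ι).Nonempty := ⟨m, Finset.mem_univ m⟩
  set g : ℝ → ℝ := fun q => Finset.univ.sup' hne fun j => f j q with hg
  have hgcont : ContinuousOn g (Set.Ico p₀ p₁) :=
    ContinuousOn.finset_sup'_apply hne fun j _ => h2 j
  have hg₀ : g p₀ ≤ 0.999 := Finset.sup'_le hne _ fun j _ => h1 j
  have hstep : ∀ q ∈ Set.Ioo p₀ p₁, g q ≤ 1 → g q ≤ 0.999 := by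
    intro q hq hq1
    refine Finset.sup'_le hne _ fun j _ => h3 q ⟨hq.1.le, hq.2⟩ (fun k => ?_) j
    exact (Finset.le_sup' (fun k => f k q) (Finset.mem_univ k)).trans hq1
  have hgp : g p ≤ 0.999 := Slade2006_lem59 (by norm_num) hgcont hg₀ hstep p hp
  exact (Finset.le_sup' (fun k => f k p) (Finset.mem_univ m)).trans hgp

/-! ### Assembly: Theorem 2.5 (= (1.20)) from subcritical bounds (Theorem 1.4, Appendix C,
Corollary 1.5), the bootstrap outputs entering as hypotheses -/

/-- The arithmetic of (1.20): `0.493 · (1 + 0.493) < 1` ("(2.18) is satisfied").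
[cite: HaraSlade1992b, Theorem 1.1 (1.20)] -/
theorem hs_C₂_numerics : (0.493 : ℝ) * (1 + 0.493) < 1 := by norm_num

/-- **(1.20) in dimension `d` from subcritical bounds below the printed constants**: if for all
`0 ≤ p < z_c(d)` one has `B_p(0) ≤ b` and `sup_x |x|² G_p(x) ≤ s` with `b ≤ 0.493`, `s ≤ 0.1425`,
then `HaraSlade1992_thm25At d` holds with `C₁ = 0.1425`, `C₂ = 0.493` (`C₂(1 + C₂) < 1`); the
passage to `0 ≤ z ≤ z_c` is Corollary 1.5 (monotone convergence,
`HaraSlade1992_thm25At_of_forall_Ioo`). This is the shape shared by the `d = 5` case (Theorem 1.4)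
and the `d ≥ 6` cases (Appendix C). [cite: HaraSlade1992b, §1.3 (proofs of Theorem 1.1 and Corollary 1.5)] -/
theorem HaraSlade1992_thm25At_of_subcritical_bounds (d : ℕ) [NeZero d] {b s : ℝ}
    (hb : b ≤ 0.493) (hs : s ≤ 0.1425)
    (h : ∀ p : ℝ, 0 ≤ p → p < criticalPoint d →
      hsBubble d p ≤ ENNReal.ofReal b ∧ hsSup d p ≤ ENNReal.ofReal s) :
    HaraSlade1992_thm25At d := by
  refine HaraSlade1992_thm25At_of_forall_Ioo (C₁ := 0.1425) (C₂ := 0.493) hs_C₂_numerics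
    (criticalPoint_pos d) fun p hp hpc => ?_
  obtain ⟨hB, hS⟩ := h p hp.le hpc
  exact ⟨fun x => (hsSup_le_iff.1 hS x).trans (ENNReal.ofReal_le_ofReal hs),
    hB.trans (ENNReal.ofReal_le_ofReal hb)⟩

/-- **`d = 5`: Theorem 1.4 ⇒ (1.20)** ("The inequalities of (1.20) are given by (1.45) and (1.39)",
with Corollary 1.5's monotone convergence for `p ↑ z_c`). The hypothesis is **Hara–Slade 1992
(Part II), Theorem 1.4, restricted to the clauses (1.39)₁ and (1.45)**: "For `d = 5` and
`p ∈ [0, z_c)`, the inequalities `P_p(0.999)` and `Q_p` hold", where the first inequality of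
`P_p(α)` (Definition 1.3, (1.39)) is `B_p(0) ≤ α·(0.493)` (here `hsBubble`, `hsBubble_eq_tsum_ite`)
and the first inequality of `Q_p` ((1.45)) is `sup_{x ∈ ℤ^d} |x|² G_p(x) ≤ 0.1425` (here `hsSup`);
nearest-neighbour strictly self-avoiding walk on `ℤ⁵`, real activities `0 ≤ p < z_c`. Its printed
proof is the computer-assisted bootstrap of §1.4 (Propositions 1.7–1.9, Lemmas 1.10–1.11); it is a
hypothesis here, not a named fact (D-0026). Conclusion: `HaraSlade1992_thm25At 5` with
`C₁ = 0.1425`, `C₂ = 0.493`.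
[cite: HaraSlade1992b, Theorem 1.4 (with Definition 1.3, eqs. (1.39), (1.45)) and §1.3 (proofs of Theorem 1.1 and Corollary 1.5)] -/
theorem HaraSlade1992_thm25At_five_of_thm14
    (h : ∀ p : ℝ, 0 ≤ p → p < criticalPoint 5 →
      hsBubble 5 p ≤ ENNReal.ofReal (0.999 * 0.493) ∧ hsSup 5 p ≤ ENNReal.ofReal 0.1425) :
    HaraSlade1992_thm25At 5 := by
  haveI : NeZero (5 : ℕ) := ⟨by norm_num⟩
  exact HaraSlade1992_thm25At_of_subcritical_bounds 5 (b := 0.999 * 0.493) (s := 0.1425)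
    (by norm_num) le_rfl h

/-- **`6 ≤ d ≤ 9`: Appendix C.1 ⇒ (1.20)**. The hypothesis is the bootstrap output of App. C.1 in
the `α = 1` form of the printed "resulting bounds": for `0 ≤ p < z_c(d)`, `B_p(0) ≤ 0.26` and
`sup_{x≠0} |x|² G_p(x) ≤ 0.11` ((C.1) with (C.3); the source prints these as a sketch — "We omit any
detailed account of the calculation, but only give the resulting bounds"). A hypothesis here, not
a named fact (D-0026). Its constants are below `0.493`, `0.1425`.
[cite: HaraSlade1992b, Appendix C.1 (eqs. (C.1), (C.3)) and §1.3 (proof of Theorem 1.1: "For `d ≥ 6`, we proceed similarly")] -/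
theorem HaraSlade1992_thm25At_of_appC1 {d : ℕ} (hd : 6 ≤ d)
    (h : ∀ p : ℝ, 0 ≤ p → p < criticalPoint d →
      hsBubble d p ≤ ENNReal.ofReal 0.26 ∧
        ∀ x : Site d, x ≠ 0 → ENNReal.ofReal (normSq x) * twoPointENN d p x ≤ ENNReal.ofReal 0.11) :
    HaraSlade1992_thm25At d := by
  haveI : NeZero d := ⟨by omega⟩
  refine HaraSlade1992_thm25At_of_subcritical_bounds d (b := 0.26) (s := 0.11)
    (by norm_num) (by norm_num) fun p hp hpc => ?_
  obtain ⟨hB, hS⟩ := h p hp hpc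
  exact ⟨hB, hsSup_le_iff.2 (normSq_mul_twoPointENN_le_of_ne_zero hS)⟩

/-- **`d ≥ 10`: Appendix C.2 ⇒ (1.20)**. The hypothesis is the bootstrap output of App. C.2: for
`0 ≤ p < z_c(d)`, `B_p(0) ≤ 0.10` and `sup_x |x|² G_p(x) ≤ 0.10` ((C.6) with (C.10): "and can
complete the proof that `P_p(0.999)` is satisfied"; bounds uniform in `d ≥ 10` by the monotonicity
Lemma C.1). A hypothesis here, not a named fact (D-0026). Its constants are below `0.493`, `0.1425`.
[cite: HaraSlade1992b, Appendix C.2 (eqs. (C.6), (C.10), Lemma C.1) and §1.3 (proof of Theorem 1.1)] -/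
theorem HaraSlade1992_thm25At_of_appC2 {d : ℕ} (hd : 10 ≤ d)
    (h : ∀ p : ℝ, 0 ≤ p → p < criticalPoint d →
      hsBubble d p ≤ ENNReal.ofReal 0.10 ∧ hsSup d p ≤ ENNReal.ofReal 0.10) :
    HaraSlade1992_thm25At d := by
  haveI : NeZero d := ⟨by omega⟩
  exact HaraSlade1992_thm25At_of_subcritical_bounds d (b := 0.10) (s := 0.10)
    (by norm_num) (by norm_num) h

/-- **`d ≥ 6`: Appendix C ⇒ (1.20)**, both ranges together: the outputs of App. C.1
(`6 ≤ d ≤ 9`) and App. C.2 (`d ≥ 10`) give `HaraSlade1992_thm25At d` for every `d ≥ 6`, with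
`C₁ = 0.1425`, `C₂ = 0.493`. [cite: HaraSlade1992b, Appendix C and §1.3 (proof of Theorem 1.1: "For `d ≥ 6`, we proceed similarly")] -/
theorem HaraSlade1992_thm25At_of_appC
    (hC1 : ∀ d : ℕ, 6 ≤ d → d ≤ 9 → ∀ p : ℝ, 0 ≤ p → p < criticalPoint d →
      hsBubble d p ≤ ENNReal.ofReal 0.26 ∧
        ∀ x : Site d, x ≠ 0 → ENNReal.ofReal (normSq x) * twoPointENN d p x ≤ ENNReal.ofReal 0.11)
    (hC2 : ∀ d : ℕ, 10 ≤ d → ∀ p : ℝ, 0 ≤ p → p < criticalPoint d →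
      hsBubble d p ≤ ENNReal.ofReal 0.10 ∧ hsSup d p ≤ ENNReal.ofReal 0.10)
    {d : ℕ} (hd : 6 ≤ d) : HaraSlade1992_thm25At d := by
  rcases le_or_gt d 9 with hd9 | hd9
  · exact HaraSlade1992_thm25At_of_appC1 hd (hC1 d hd hd9)
  · exact HaraSlade1992_thm25At_of_appC2 (by omega) (hC2 d (by omega))

/-- **Hara–Slade 1992, Part I Theorem 2.5 (= Part II Theorem 1.1, (1.20)) from Part II's own
reduction**: Theorem 1.4 (`d = 5`), Appendix C.1 (`6 ≤ d ≤ 9`) and Appendix C.2 (`d ≥ 10`), all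
for real `p < z_c`, give Theorem 2.5 for all `d ≥ 5` with the uniform constants `C₁ = 0.1425`,
`C₂ = 0.493`, `C₂(1 + C₂) < 1`; the passage to `0 ≤ z ≤ z_c` is Corollary 1.5 (monotone
convergence), proved in `LaceExpansionBubbleFiveDimSubcritical.lean`. The three hypotheses are the
computer-assisted bootstrap outputs of Part II, stated with their printed constants; they are not
named facts (D-0026). [cite: HaraSlade1992b, §1.3 (proof of Theorem 1.1), Theorem 1.4 and Appendix C]
[cite: HaraSlade1992, Theorem 2.5] -/
theorem HaraSlade1992_thm25_of_partII
    (h14 : ∀ p : ℝ, 0 ≤ p → p < criticalPoint 5 →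
      hsBubble 5 p ≤ ENNReal.ofReal (0.999 * 0.493) ∧ hsSup 5 p ≤ ENNReal.ofReal 0.1425)
    (hC1 : ∀ d : ℕ, 6 ≤ d → d ≤ 9 → ∀ p : ℝ, 0 ≤ p → p < criticalPoint d →
      hsBubble d p ≤ ENNReal.ofReal 0.26 ∧
        ∀ x : Site d, x ≠ 0 → ENNReal.ofReal (normSq x) * twoPointENN d p x ≤ ENNReal.ofReal 0.11)
    (hC2 : ∀ d : ℕ, 10 ≤ d → ∀ p : ℝ, 0 ≤ p → p < criticalPoint d →
      hsBubble d p ≤ ENNReal.ofReal 0.10 ∧ hsSup d p ≤ ENNReal.ofReal 0.10) :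
    HaraSlade1992_thm25 := by
  rw [HaraSlade1992_thm25_iff_forall]
  intro d hd
  rcases eq_or_lt_of_le hd with rfl | hd6
  · exact HaraSlade1992_thm25At_five_of_thm14 h14
  · exact HaraSlade1992_thm25At_of_appC hC1 hC2 hd6

/-- **Theorem 2.5 from (1.20) for real subcritical activities** (the one-hypothesis form of the
reduction): if for every `d ≥ 5` and every `0 ≤ p < z_c(d)` one has `B_p(0) ≤ 0.493` and
`sup_x |x|² G_p(x) ≤ 0.1425` — the clause (1.20) of Theorem 1.1 restricted to `p ∈ [0, z_c)`, which
is what Theorem 1.4 / Appendix C deliver before Corollary 1.5 — then `HaraSlade1992_thm25` holds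
(constants `0.1425`, `0.493`). Supplying this hypothesis — the statement Part II proves — is
the intended road to a discharge of the named fact `HaraSlade1992_thm25`.
[cite: HaraSlade1992b, Theorem 1.1 (1.20) and §1.3 (proof of Corollary 1.5)]
[cite: HaraSlade1992, Theorem 2.5] -/
theorem HaraSlade1992_thm25_of_eq120_subcritical
    (h : ∀ d : ℕ, 5 ≤ d → ∀ p : ℝ, 0 ≤ p → p < criticalPoint d →
      hsBubble d p ≤ ENNReal.ofReal 0.493 ∧ hsSup d p ≤ ENNReal.ofReal 0.1425) :
    HaraSlade1992_thm25 := by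
  rw [HaraSlade1992_thm25_iff_forall]
  intro d hd
  haveI : NeZero d := ⟨by omega⟩
  exact HaraSlade1992_thm25At_of_subcritical_bounds d le_rfl le_rfl (h d hd)

/-- **The parent fact straight from the subcritical form of (1.20)**: (1.20) for all `d ≥ 5` and
real `0 ≤ p < z_c` gives the bubble condition `B(z_c) < ∞` for all `d ≥ 5`
(`HaraSlade1992_bubbleCondition`, via Theorem 2.5 and Part I, §3.1). [cite: HaraSlade1992b, Theorem 1.1 (1.20)] [cite: HaraSlade1992, §3.1 (proof of Theorem 1.2)] -/
theorem HaraSlade1992_bubbleCondition_of_eq120_subcritical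
    (h : ∀ d : ℕ, 5 ≤ d → ∀ p : ℝ, 0 ≤ p → p < criticalPoint d →
      hsBubble d p ≤ ENNReal.ofReal 0.493 ∧ hsSup d p ≤ ENNReal.ofReal 0.1425) :
    HaraSlade1992_bubbleCondition :=
  HaraSlade1992_bubbleCondition_of_thm25 (HaraSlade1992_thm25_of_eq120_subcritical h)

/-- **The parent fact from Part II's three bootstrap outputs** (Theorem 1.4, App. C.1, App. C.2).
[cite: HaraSlade1992b, §1.3 (proof of Theorem 1.1) and Appendix C] [cite: HaraSlade1992, §3.1] -/
theorem HaraSlade1992_bubbleCondition_of_partII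
    (h14 : ∀ p : ℝ, 0 ≤ p → p < criticalPoint 5 →
      hsBubble 5 p ≤ ENNReal.ofReal (0.999 * 0.493) ∧ hsSup 5 p ≤ ENNReal.ofReal 0.1425)
    (hC1 : ∀ d : ℕ, 6 ≤ d → d ≤ 9 → ∀ p : ℝ, 0 ≤ p → p < criticalPoint d →
      hsBubble d p ≤ ENNReal.ofReal 0.26 ∧
        ∀ x : Site d, x ≠ 0 → ENNReal.ofReal (normSq x) * twoPointENN d p x ≤ ENNReal.ofReal 0.11)
    (hC2 : ∀ d : ℕ, 10 ≤ d → ∀ p : ℝ, 0 ≤ p → p < criticalPoint d →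
      hsBubble d p ≤ ENNReal.ofReal 0.10 ∧ hsSup d p ≤ ENNReal.ofReal 0.10) :
    HaraSlade1992_bubbleCondition :=
  HaraSlade1992_bubbleCondition_of_thm25 (HaraSlade1992_thm25_of_partII h14 hC1 hC2)

end Literature.Barriers.CriticalPhenomena
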